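import Mathlib.Topology.MetricSpace.Lipschitz
import Mathlib.Order.Filter.AtTopBot.Field
import Literature.Geometry.Lorentzian.MinkowskiCauchy
import Literature.Geometry.Lorentzian.CausalityAchronalProofs
import HarnessLib

/-!
# A Cauchy hypersurface of Minkowski space-time is an entire Lipschitz graph over `{t = 0}`

Beig–Chruściel, J. Math. Phys. 37 (1996), proof of Thm. 4.1 (the rigid positive energy
theorem), last step: *"As `Σ̃` is a Cauchy surface for `M̄` [= Minkowski space-time], it is
necessarily a graph over a spacelike plane `t = 0` in `(ℝ⁴, η_{μν})`. In particular `Σ̃` has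
only one asymptotically flat end."* This file proves the first sentence for the tree's
(corrected) notion `LorentzianMetric.IsCauchyHypersurface` (O'Neill 1983, Def. 14.28: met
exactly once by every endless timelike curve) of Minkowski space-time `Minkowski.spacetime =
(ℝ⁴, η, ∂ₜ)`, from Mathlib alone (theorems only; no definition, no named fact):

* `Minkowski.isEndlessTimelikeCurve_line` — a straight line `σ ↦ p + σ v` with future timelike
  velocity (`η(v, v) < 0`, `v⁰ > 0`) is an endless timelike curve (its time coordinate is the
  affine function `p⁰ + σ v⁰`, unbounded in both directions, so there is no endpoint).
* `Minkowski.IsCauchyHypersurface.exists_lipschitzWith_eq_range_graph` — **a Cauchy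
  hypersurface `S` of Minkowski space-time is the entire graph `{(u(y), y) | y ∈ ℝ³}` of a
  `1`-Lipschitz function `u : ℝ³ → ℝ`**: the vertical lines `σ ↦ (σ, y)` are endless timelike
  curves, each meeting `S` exactly once, at height `u(y)`; and if `|u(y) − u(y')| > ‖y − y'‖`
  the straight line through the two graph points would be an endless *timelike* curve meeting
  `S` twice.

Together with `Minkowski.isCauchyHypersurface_range_graph`
(`SpacetimePositiveMassRigidityProofs`: graphs of `θ`-Lipschitz functions with `θ < 1` are
Cauchy) this brackets the Cauchy hypersurfaces of Minkowski space-time between the uniformly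
spacelike and the `1`-Lipschitz entire graphs. The converse of the present theorem fails: the
null hyperplane `t = y₁` is a `1`-Lipschitz entire graph which the endless timelike curve
`t ↦ (t, t + π/2 − arctan t, 0, 0)` never meets.

## References

* R. Beig, P. T. Chruściel, *Killing vectors in asymptotically flat space-times. I.*, J. Math.
  Phys. 37 (1996) 1939–1961, arXiv:gr-qc/9510015: proof of Thm. 4.1 (§4, last paragraph).
  [BeigChrusciel1996]
* B. O'Neill, *Semi-Riemannian geometry*, Academic Press 1983, Ch. 5, p. 145 (timecones of
  `ℝ⁴₁`) and Ch. 14, Def. 14.28 (p. 415). [ONeillSemiRiemannian1983]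
* S. W. Hawking, G. F. R. Ellis, *The large scale structure of space-time*, CUP 1973, §6.2
  (endpoints), §6.5.
-/

noncomputable section

open Bundle Set Filter Function Topology
open scoped Manifold ContDiff NNReal

namespace Literature.Geometry.Lorentzian

namespace Minkowski

/-- **Straight lines with future timelike velocity are endless timelike curves of Minkowski
space-time**: for `p, v ∈ ℝ⁴` with `η(v, v) < 0` and `v⁰ > 0`, the curve `σ ↦ p + σ v` on `ℝ` is
a future-directed timelike curve (constant velocity `v`) without future or past endpoint (its
time coordinate `p⁰ + σ v⁰` tends to `±∞`). O'Neill 1983, Ch. 5, p. 145 (timecones of `ℝ⁴₁`)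
and Ch. 14, p. 409; Hawking–Ellis 1973, §6.2.
[cite: ONeillSemiRiemannian1983, Ch. 14, Def. 14.28 (p. 415)] -/
theorem isEndlessTimelikeCurve_line (p v : E4) (hv : bilin v v < 0) (hv0 : 0 < v 0) :
    spacetime.metric.IsEndlessTimelikeCurve spacetime.timeOrientation
      (fun σ : ℝ ↦ p + σ • v) univ := by
  have hne : v ≠ 0 := by
    rintro rfl
    simp at hv0
  have he0 : bilin (E4.basisVector 0) v < 0 := by
    rw [bilin_basisVector_zero_left]; linarith
  have htime : ∀ σ : ℝ, (p + σ • v) 0 = p 0 + σ * v 0 := fun σ ↦ by simp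
  refine ⟨ordConnected_univ, fun t _ ↦ ?_, ⟨univ_nonempty, fun q hq ↦ ?_⟩,
    ⟨univ_nonempty, fun q hq ↦ ?_⟩⟩
  · have hd : HasDerivAt (fun σ : ℝ ↦ p + σ • v) v t := by
      simpa using ((hasDerivAt_id t).smul_const v).const_add p
    exact LorentzianMetric.futureTimelikeAt_of_hasMFDerivAt (g := spacetime.metric)
      (τ := spacetime.timeOrientation) rfl (hasMFDerivAt_iff_hasFDerivAt.mpr hd.hasFDerivAt)
      hv ⟨⟨hv.le, hne⟩, he0⟩
  · -- no future endpoint: the time coordinate tends to `+∞`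
    set q' : E4 := q
    rw [hasFutureEndpoint_iff_tendsto_atTop (subset_univ (Ici 0))] at hq
    have h1 : Tendsto (fun σ : ℝ ↦ (p + σ • v) 0) atTop (𝓝 (q' 0)) :=
      ((EuclideanSpace.proj (0 : Fin 4)).continuous.tendsto q').comp hq
    simp only [htime] at h1
    exact not_tendsto_nhds_of_tendsto_atTop
      (tendsto_atTop_add_const_left _ _ (tendsto_id.atTop_mul_const hv0)) (q' 0) h1
  · -- no past endpoint: the time coordinate tends to `−∞`
    set q' : E4 := q
    rw [hasPastEndpoint_iff_tendsto_atBot (subset_univ (Iic 0))] at hq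
    have h1 : Tendsto (fun σ : ℝ ↦ (p + σ • v) 0) atBot (𝓝 (q' 0)) :=
      ((EuclideanSpace.proj (0 : Fin 4)).continuous.tendsto q').comp hq
    simp only [htime] at h1
    exact not_tendsto_nhds_of_tendsto_atBot
      (tendsto_atBot_add_const_left _ _ (tendsto_id.atBot_mul_const hv0)) (q' 0) h1

/-- **The vertical lines `σ ↦ (σ, y)` are endless timelike curves of Minkowski space-time**
(velocity `∂ₜ`; the case `p = (0, y)`, `v = ∂ₜ` of `isEndlessTimelikeCurve_line`). O'Neill 1983,
Ch. 14, remark after Def. 14.28 (p. 415).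
[cite: ONeillSemiRiemannian1983, Ch. 14, Def. 14.28 (p. 415)] -/
theorem isEndlessTimelikeCurve_vertical (y : E3) :
    spacetime.metric.IsEndlessTimelikeCurve spacetime.timeOrientation
      (fun σ : ℝ ↦ E4.ofTimeSpace σ y) univ := by
  have hγ : (fun σ : ℝ ↦ E4.ofTimeSpace σ y) =
      fun σ ↦ E4.ofTimeSpace 0 y + σ • E4.basisVector 0 := by
    funext σ
    rw [E4.ofTimeSpace_eq_smul_add, add_comm]
  rw [hγ]
  refine isEndlessTimelikeCurve_line _ _ ?_ (by simp)
  rw [bilin_basisVector_zero]; norm_num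

/-- **A Cauchy hypersurface of Minkowski space-time is an entire `1`-Lipschitz graph over
`{t = 0}`.** If `S ⊆ (ℝ⁴, η, ∂ₜ)` is a Cauchy hypersurface (`LorentzianMetric.IsCauchyHypersurface`,
O'Neill 1983, Def. 14.28), there is a `1`-Lipschitz `u : ℝ³ → ℝ` with
`S = {(u(y), y) | y ∈ ℝ³}`: each vertical line `σ ↦ (σ, y)` is an endless timelike curve
(`isEndlessTimelikeCurve_vertical`) and meets `S` exactly once, at height `u(y)`; and were
`u(y') − u(y) > ‖y' − y‖`, the straight line through `(u(y), y)` and `(u(y'), y')` would have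
future timelike velocity, hence be an endless timelike curve (`isEndlessTimelikeCurve_line`)
meeting `S` at the two parameters `0 ≠ 1`. This is the step *"as `Σ̃` is a Cauchy surface for
[Minkowski space-time], it is necessarily a graph over a spacelike plane `t = 0`"* of the proof
of Beig–Chruściel, J. Math. Phys. 37 (1996), Thm. 4.1 (§4, last paragraph).
[cite: BeigChrusciel1996, proof of Thm. 4.1, §4 (last paragraph)] -/
theorem IsCauchyHypersurface.exists_lipschitzWith_eq_range_graph {S : Set E4}
    (hS : spacetime.metric.IsCauchyHypersurface spacetime.timeOrientation S) :
    ∃ u : E3 → ℝ, LipschitzWith 1 u ∧ S = range fun y : E3 ↦ E4.ofTimeSpace (u y) y := by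
  -- each vertical line meets `S` exactly once
  have key : ∀ y : E3, ∃! σ : ℝ, E4.ofTimeSpace σ y ∈ S := by
    intro y
    obtain ⟨σ, ⟨-, hσ⟩, huniq⟩ := hS _ _ (isEndlessTimelikeCurve_vertical y)
    exact ⟨σ, hσ, fun τ hτ ↦ huniq τ ⟨mem_univ _, hτ⟩⟩
  choose u hu using fun y ↦ (key y).exists
  have huniq : ∀ y σ, E4.ofTimeSpace σ y ∈ S → σ = u y := fun y σ hσ ↦
    (key y).unique hσ (hu y)
  -- `S` is the graph of `u`
  have hS' : S = range fun y : E3 ↦ E4.ofTimeSpace (u y) y := by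
    ext x
    constructor
    · intro hx
      refine ⟨E4.spatial x, ?_⟩
      have hx' : E4.ofTimeSpace (x 0) (E4.spatial x) = x := by
        rw [← E4.time_apply, E4.ofTimeSpace_time_spatial]
      change E4.ofTimeSpace (u (E4.spatial x)) (E4.spatial x) = x
      rw [← huniq (E4.spatial x) (x 0) (hx'.symm ▸ hx), hx']
    · rintro ⟨y, rfl⟩
      exact hu y
  refine ⟨u, LipschitzWith.of_le_add fun y' y ↦ ?_, hS'⟩
  -- `u y' ≤ u y + ‖y' − y‖`: otherwise the chord is an endless timelike curve meeting `S` twice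
  by_contra hle
  have hlt : u y + ‖y' - y‖ < u y' := by rwa [not_le, dist_eq_norm] at hle
  set P : E4 := E4.ofTimeSpace (u y) y with hP
  set Q : E4 := E4.ofTimeSpace (u y') y' with hQ
  set v : E4 := Q - P with hv
  have hv0 : v 0 = u y' - u y := by simp [hv, hP, hQ]
  have hvs : ∀ i : Fin 3, v i.succ = (y' - y) i := fun i ↦ by simp [hv, hP, hQ]
  have hpos : 0 < v 0 := by rw [hv0]; linarith [norm_nonneg (y' - y)]
  have htl : bilin v v < 0 := by
    rw [bilin_apply]
    have hsq : ∑ i : Fin 3, v i.succ * v i.succ = ‖y' - y‖ ^ 2 := by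
      rw [EuclideanSpace.real_norm_sq_eq]
      exact Finset.sum_congr rfl fun i _ ↦ by rw [hvs, pow_two]
    rw [hsq, hv0]
    have h1 : ‖y' - y‖ < u y' - u y := by linarith
    nlinarith [norm_nonneg (y' - y)]
  have hγ0 : (fun σ : ℝ ↦ P + σ • v) 0 ∈ S := by
    show P + (0 : ℝ) • v ∈ S
    rw [zero_smul, add_zero]
    exact hu y
  have hγ1 : (fun σ : ℝ ↦ P + σ • v) 1 ∈ S := by
    show P + (1 : ℝ) • v ∈ S
    rw [one_smul, hv, add_sub_cancel]
    exact hu y'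
  obtain ⟨σ₀, -, huniqσ⟩ := hS _ _ (isEndlessTimelikeCurve_line P v htl hpos)
  have h0 : (0 : ℝ) = σ₀ := huniqσ 0 ⟨mem_univ _, hγ0⟩
  have h1 : (1 : ℝ) = σ₀ := huniqσ 1 ⟨mem_univ _, hγ1⟩
  exact zero_ne_one (h0.trans h1.symm)

end Minkowski

end Literature.Geometry.Lorentzian

end
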